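import Summits.QuantumFields.YangMills.Theorems.PoincareLipschitzRadialPushforward
import Summits.QuantumFields.YangMills.Theorems.PoincareLipschitzRadialLebesguePushforward
import Summits.QuantumFields.YangMills.Theorems.PoincareLipschitzHardyLogProfile
import Mathlib.Analysis.Calculus.BumpFunction.FiniteDimension
import Mathlib.Analysis.Calculus.LocalExtr.Basic
import Mathlib.Analysis.Calculus.FDeriv.Measurable
import HarnessLib

/-!
# Crux `BlockLipschitzL` (stmt-QuantumFields-23533) ∕ `HistoryTailL` (stmt-QuantumFields-19936), LINE 25 «CompactnessTransfer»,
# stub S1″ — the (TM) road, file TM-F2b «THE DENSITY CAP `Θ ≤ 3π`»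

Cell `ym3-torus` (YM ladder rung R3 = continuum SU(2) Yang–Mills on T³ — a RUNG, NOT Clay: not d = 4, not infinite volume,
not a mass gap); WIDTH helper seat `ym3-torus-px3` g9 (LEAD ★w1-19936 g10 «GO (i)» 15:27:31Z); `--supports
stmt-QuantumFields-23533`; THEOREMS ONLY (0 `def`, 0 `sorry`, default heartbeats); imports TM-F1 ✓`…RadialPushforward`
(weighted radial push-forward, radial test functions), px22 g7's ✓`…RadialLebesguePushforward` (★★★`setIntegral_ball_dist_eq`: the
Lebesgue radial push-forward `∫_{B_R(y)} h(dist) = 4π∫₀^R r²h`, over lit ✓`BallRadialMoments` — the letter of record for the `|∇ζ|²` side),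
TM-F2a ✓`…HardyLogProfile` (the logarithmic Hardy profiles), Mathlib.

WHAT THIS FILE DOES.  ★★★ `slope_le_three_pi` — **THE DENSITY CAP**: if a density `d ≥ 0`, integrable on `B_ρ(y) ⊂ ℝ³`,
has LINEAR ball integrals `∫_{B_r(y)} d = Θ·r` (`0 < r ≤ ρ`) and satisfies the STABILITY ROW
`∫_{B_ρ} ζ²·d ≤ 3·∫_{B_ρ} Σᵢ(∂ᵢζ)²` for all `ζ ∈ C_c^∞(B_{ρ′}(y))`, `ρ′ < ρ` — the conclusion of w7 g14's ★★★`stability` ∕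
`stability_of_cubeMinimiser` [SchoenUhlenbeck1984 (1.3)–(1.5)] for the Dirichlet density of a ball minimiser into `S³ ⊂ ℝ⁴`,
token for token — then `Θ ≤ 3π`.  With the monotonicity equality (TM-C) and the blow-up (TM-D): EVERY MINIMIZING TANGENT MAP
`ℝ³ → S³` HAS DENSITY `Θ = E_{S²}(ω) ≤ 3π`, by kernel; the named residue of (TM) [SchoenUhlenbeck1984, Prop. 1.2] is thus
exactly «no minimizing tangent map `ℝ³ → S³` has `0 < Θ ≤ 3π`» — the `8π` energy gap for (weakly) harmonic 2-spheres
[SchoenUhlenbeck1984, Lemma 1.1], whose printed proofs use Hélein's regularity of weakly harmonic maps of surfaces; NOT proved here.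
PROOF (no limits of quotients): radial test functions `ζ_L = F_L(‖·−y‖)` with the logarithmic Hardy profiles
`F_L(r) = Ψ((log r − log ρ)∕L)∕√r` of TM-F2a (`Ψ` one fixed `ContDiffBump` on `ℝ` supported in `(−2,−1)`): by the weighted
radial push-forward of TM-F1 and px22's Lebesgue one, stability reads `Θ·∫₀^ρ F_L² ≤ 12π·∫₀^ρ r²F_L′²`, i.e. `Θ·L·A ≤ 12π(B∕L + L·A∕4)` with `A = ∫Ψ² ≥ ½`,
`B = ∫Ψ′²`; so `(Θ − 3π)·A ≤ 12πB∕L²` for every `L > 0`, whence `Θ ≤ 3π`.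
★★ `slope_le_three_pi_of_ballMinimiser` specialises `d := Σᵢ‖G eᵢ‖²` (any `G`) — the form TM-G will feed from w7's `stability`.
HONEST SCOPE.  The stability row is a HYPOTHESIS here (w7 g14's theorem supplies it for ball minimisers); (TM), (ZD), (C), S1″,
K1, `MeanDeviationL`, `BlockLipschitzL`, `HistoryTailL` NOT proved.  YM₃ on T³ is rung R3, not Clay; YM gap NOT proved; no
summit statement is proved here.

References: R. Schoen, K. Uhlenbeck, Invent. Math. 78 (1984) 89–100 [SchoenUhlenbeck1984] (§1: (1.3)–(1.5), Lemma 1.1,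
Prop. 1.2, Lemma 1.3); L. Simon (1996) [Simon1996] (§3.1 densities of tangent maps).
-/

set_option autoImplicit false

noncomputable section

open scoped BigOperators Topology ContDiff
open MeasureTheory Set Filter Metric Function TopologicalSpace intervalIntegral

namespace Summit.QuantumFields.YangMills.Theorems.PoincareLipschitzTangentMapDensityCap

open Summit.QuantumFields.YangMills.Theorems.PoincareLipschitzRadialPushforward
open Summit.QuantumFields.YangMills.Theorems.PoincareLipschitzRadialLebesguePushforward (setIntegral_ball_dist_eq)
open Summit.QuantumFields.YangMills.Theorems.PoincareLipschitzHardyLogProfile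

/-! ## §1 One fixed bump on `ℝ` supported in `(−2, −1)` -/

/-- A smooth bump `Ψ ≥ 0` on `ℝ` with `Ψ = 1` on `[−7∕4, −5∕4]`, `Ψ = Ψ′ = 0` off `(−2, −1)`, and `∫_{−2}^{−1} Ψ² ≥ ½`
(Mathlib's `ContDiffBump` centred at `−3∕2`). [folklore] -/
theorem exists_bump :
    ∃ Ψ : ℝ → ℝ, ContDiff ℝ ∞ Ψ ∧ (∀ u : ℝ, u ≤ -2 ∨ -1 ≤ u → Ψ u = 0) ∧ (∀ u : ℝ, u ≤ -2 ∨ -1 ≤ u → deriv Ψ u = 0) ∧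
      (1 / 2 : ℝ) ≤ ∫ u in (-2:ℝ)..(-1), Ψ u ^ 2 := by
  let χ : ContDiffBump (-(3 / 2) : ℝ) := ⟨1 / 4, 1 / 2, by norm_num, by norm_num⟩
  have hout : ∀ u : ℝ, u ≤ -2 ∨ -1 ≤ u → χ.rOut ≤ dist u (-(3 / 2) : ℝ) := by
    intro u hu
    show (1 / 2 : ℝ) ≤ dist u (-(3 / 2))
    rw [Real.dist_eq]
    rcases hu with hu | hu
    · rw [abs_of_nonpos (by linarith)]; linarith
    · rw [abs_of_nonneg (by linarith)]; linarith
  have h0 : ∀ u : ℝ, u ≤ -2 ∨ -1 ≤ u → (χ : ℝ → ℝ) u = 0 := fun u hu => χ.zero_of_le_dist (hout u hu)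
  refine ⟨χ, χ.contDiff, h0, fun u hu => ?_, ?_⟩
  · have hmin : IsLocalMin (χ : ℝ → ℝ) u := Filter.Eventually.of_forall fun z => by rw [h0 u hu]; exact χ.nonneg
    exact hmin.deriv_eq_zero
  · have hone : ∀ u ∈ uIcc (-(7 / 4) : ℝ) (-(5 / 4)), ((χ : ℝ → ℝ) u) ^ 2 = 1 := by
      intro u hu
      rw [uIcc_of_le (by norm_num)] at hu
      have : u ∈ closedBall (-(3 / 2) : ℝ) χ.rIn := by
        show dist u (-(3 / 2)) ≤ 1 / 4
        rw [Real.dist_eq, abs_le]; constructor <;> linarith [hu.1, hu.2]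
      rw [χ.one_of_mem_closedBall this, one_pow]
    have hci : IntervalIntegrable (fun u => ((χ : ℝ → ℝ) u) ^ 2) volume (-2:ℝ) (-1) :=
      (χ.continuous.pow 2).intervalIntegrable _ _
    have hmono := intervalIntegral.integral_mono_interval (μ := volume) (f := fun u => ((χ : ℝ → ℝ) u) ^ 2)
      (show (-2:ℝ) ≤ -(7 / 4) by norm_num) (show (-(7 / 4) : ℝ) ≤ -(5 / 4) by norm_num) (show (-(5 / 4) : ℝ) ≤ -1 by norm_num)
      (Eventually.of_forall fun u => sq_nonneg _) hci
    rw [intervalIntegral.integral_congr hone, intervalIntegral.integral_const, smul_eq_mul, mul_one] at hmono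
    norm_num at hmono
    exact hmono

/-! ## §2 The density cap -/

/-- ★★★ **THE DENSITY CAP `Θ ≤ 3π`.**  Let `d ≥ 0` be integrable on `B_ρ(y) ⊂ ℝ³` with LINEAR ball integrals
`∫_{B_r(y)} d = Θ·r` (`0 < r ≤ ρ`), and suppose the STABILITY ROW: for every `ρ′ < ρ` and every `ζ ∈ C^∞` with
`tsupport ζ ⊆ B_{ρ′}(y)`, `∫_{B_ρ} ζ²·d ≤ 3·∫_{B_ρ} Σᵢ (∂ᵢζ)²` ([SchoenUhlenbeck1984, (1.3)–(1.5)] for the Dirichlet density of a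
ball minimiser into `S³ ⊂ ℝ⁴`; w7 g14's ★★★`stability`).  Then `Θ ≤ 3π`: stability against the logarithmic Hardy profiles
gives `(Θ − 3π)·A ≤ 12π·B∕L²` for all `L > 0`. [cite: SchoenUhlenbeck1984, §1 (1.3)–(1.5), Prop. 1.2 and Lemma 1.3; Simon1996, §3.1] -/
theorem slope_le_three_pi {y : EuclideanSpace ℝ (Fin 3)} {ρ Θ : ℝ} (hρ : 0 < ρ)
    {d : EuclideanSpace ℝ (Fin 3) → ℝ} (hd0 : ∀ x, 0 ≤ d x) (hdi : IntegrableOn d (ball y ρ) volume)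
    (hlin : ∀ r : ℝ, 0 < r → r ≤ ρ → ∫ x in ball y r, d x = Θ * r)
    (hStab : ∀ ρ' : ℝ, ρ' < ρ → ∀ ζ : EuclideanSpace ℝ (Fin 3) → ℝ, ContDiff ℝ ∞ ζ → tsupport ζ ⊆ ball y ρ' →
      ∫ x in ball y ρ, ζ x ^ 2 * d x ≤ 3 * ∫ x in ball y ρ, ∑ i : Fin 3, fderiv ℝ ζ x (EuclideanSpace.single i (1:ℝ)) ^ 2) :
    Θ ≤ 3 * Real.pi := by
  obtain ⟨Ψ, hΨ, hΨ0, hΨ'0, hA⟩ := exists_bump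
  set A : ℝ := ∫ u in (-2:ℝ)..(-1), Ψ u ^ 2 with hA_def
  set B : ℝ := ∫ u in (-2:ℝ)..(-1), deriv Ψ u ^ 2 with hB_def
  have hB0 : 0 ≤ B := intervalIntegral.integral_nonneg (by norm_num) fun u _ => sq_nonneg _
  set c : ℝ := Real.log ρ with hc_def
  -- the key estimate for each scale `L > 0`
  have key : ∀ L : ℝ, 0 < L → (Θ - 3 * Real.pi) * (L * A) ≤ 12 * Real.pi * (B / L) := by
    intro L hL
    -- the profile and its radial test function
    set F : ℝ → ℝ := fun r => Ψ ((Real.log r - c) / L) * (Real.sqrt r)⁻¹ with hF_def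
    have hδ : 0 < Real.exp (c - 2 * L) := Real.exp_pos _
    have hF0 : ∀ r : ℝ, r < Real.exp (c - 2 * L) → F r = 0 := fun r hr => logProfile_eq_zero_of_le hΨ0 hL hr.le
    have hFs : ∀ r : ℝ, 0 < r → ContDiffAt ℝ ∞ F r := fun r hr => contDiffAt_logProfile hΨ c L hr
    have hexp1 : Real.exp (c - L) = ρ * Real.exp (-L) := by rw [sub_eq_add_neg, Real.exp_add, hc_def, Real.exp_log hρ]
    have hexpρ : Real.exp (c - L) < ρ := by
      rw [hexp1]
      have : Real.exp (-L) < 1 := Real.exp_lt_one_iff.2 (by linarith)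
      nlinarith
    set ρ' : ℝ := (Real.exp (c - L) + ρ) / 2 with hρ'_def
    have hρ'ρ : ρ' < ρ := by rw [hρ'_def]; linarith
    have hζc : ContDiff ℝ ∞ (fun x : EuclideanSpace ℝ (Fin 3) => F ‖x - y‖) := contDiff_radial y hδ hF0 hFs
    have hζs : tsupport (fun x : EuclideanSpace ℝ (Fin 3) => F ‖x - y‖) ⊆ ball y ρ' :=
      (tsupport_radial_subset y (R := Real.exp (c - L)) fun r hr => logProfile_eq_zero_of_ge hΨ0 hL hr).trans
        (closedBall_subset_ball (by rw [hρ'_def]; linarith))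
    have hst := hStab ρ' hρ'ρ _ hζc hζs
    -- the left side: `Θ · L · A`
    have hFm : Measurable F := by
      refine Measurable.mul (hΨ.continuous.measurable.comp ?_) (Real.continuous_sqrt.measurable.inv)
      exact ((Real.measurable_log.sub measurable_const).div_const L)
    have hL1 : ∫ x in ball y ρ, (F ‖x - y‖) ^ 2 * d x = Θ * (L * A) := by
      have h := setIntegral_radial_mul_eq_of_ball_linear' hρ hd0 hdi hlin (k := fun r => F r ^ 2) (hFm.pow_const 2)
      simp_rw [dist_eq_norm] at h
      rw [h, integral_logProfile_sq hΨ hΨ0 hL hexpρ.le]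
    -- the right side: `4π · L · (B/L² + A/4)`
    have hR1 : ∫ x in ball y ρ, ∑ i : Fin 3, fderiv ℝ (fun x : EuclideanSpace ℝ (Fin 3) => F ‖x - y‖) x (EuclideanSpace.single i (1:ℝ)) ^ 2 =
        4 * Real.pi * (L * (B / L ^ 2 + A / 4)) := by
      simp_rw [sum_fderiv_radial_sq y hδ hF0 hFs]
      have h := setIntegral_ball_dist_eq y hρ.le (fun r => deriv F r ^ 2)
      simp_rw [dist_eq_norm] at h
      rw [h, integral_sq_mul_deriv_logProfile_sq hΨ hΨ0 hΨ'0 hL hexpρ.le, integral_profile_quadratic hΨ hΨ0 L]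
    rw [hL1, hR1] at hst
    -- `Θ·L·A ≤ 12π·B/L + 3π·L·A`
    have hLA : L * (B / L ^ 2 + A / 4) = B / L + L * A / 4 := by field_simp
    rw [hLA] at hst
    nlinarith
  -- conclude: if `Θ > 3π`, a large `L` contradicts `key`
  by_contra hΘ
  push Not at hΘ
  have hA0 : 0 < A := lt_of_lt_of_le (by norm_num) hA
  set ε : ℝ := (Θ - 3 * Real.pi) * A with hε_def
  have hε : 0 < ε := mul_pos (by linarith) hA0
  set L : ℝ := 12 * Real.pi * B / ε + 1 with hL_def
  have hL0 : 0 < L := by rw [hL_def]; positivity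
  have hL1 : 1 ≤ L := le_add_of_nonneg_left (by positivity)
  have h := key L hL0
  -- `ε·L ≤ 12πB/L ≤ 12πB`, but `ε·L ≥ ε·(12πB/ε + 1) = 12πB + ε`
  have h1 : (Θ - 3 * Real.pi) * (L * A) = ε * L := by rw [hε_def]; ring
  have h2 : 12 * Real.pi * (B / L) ≤ 12 * Real.pi * B := by
    rw [mul_div_assoc']
    exact div_le_self (by positivity) hL1
  have h3 : ε * L = 12 * Real.pi * B + ε := by rw [hL_def]; field_simp
  linarith

/-- ★★ **THE DENSITY CAP FOR DIRICHLET DENSITIES** — `slope_le_three_pi` with `d := Σᵢ‖G eᵢ‖²` for any gradient field `G`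
(the shape w7 g14's ★★★`stability` delivers for ball minimisers into `ℝ⁴ ⊃ S³`). [cite: SchoenUhlenbeck1984, §1 (1.3)–(1.5) and Prop. 1.2] -/
theorem slope_le_three_pi_of_dens {F : Type*} [NormedAddCommGroup F] [NormedSpace ℝ F]
    {y : EuclideanSpace ℝ (Fin 3)} {ρ Θ : ℝ} (hρ : 0 < ρ)
    {G : EuclideanSpace ℝ (Fin 3) → EuclideanSpace ℝ (Fin 3) →L[ℝ] F}
    (hGi : IntegrableOn (fun x => ∑ i : Fin 3, ‖G x (EuclideanSpace.single i (1:ℝ))‖ ^ 2) (ball y ρ) volume)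
    (hlin : ∀ r : ℝ, 0 < r → r ≤ ρ → ∫ x in ball y r, ∑ i : Fin 3, ‖G x (EuclideanSpace.single i (1:ℝ))‖ ^ 2 = Θ * r)
    (hStab : ∀ ρ' : ℝ, ρ' < ρ → ∀ ζ : EuclideanSpace ℝ (Fin 3) → ℝ, ContDiff ℝ ∞ ζ → tsupport ζ ⊆ ball y ρ' →
      ∫ x in ball y ρ, ζ x ^ 2 * ∑ i : Fin 3, ‖G x (EuclideanSpace.single i (1:ℝ))‖ ^ 2 ≤
        3 * ∫ x in ball y ρ, ∑ i : Fin 3, fderiv ℝ ζ x (EuclideanSpace.single i (1:ℝ)) ^ 2) :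
    Θ ≤ 3 * Real.pi :=
  slope_le_three_pi hρ (fun x => Finset.sum_nonneg fun i _ => by positivity) hGi hlin hStab

end Summit.QuantumFields.YangMills.Theorems.PoincareLipschitzTangentMapDensityCap

end
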